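import Summits.AtomisticToContinuum.HydrodynamicLimit.Theorems.CollisionIsometryCLTAdaptedWeightCLTTLReductionFold
import Summits.AtomisticToContinuum.HydrodynamicLimit.Theorems.CollisionIsometryCLTAdaptedWeightCLTTLReductionBounds
import Literature.Analysis.FluidPDE.HardSphereFlowGroup
import Literature.Analysis.FluidPDE.HardSphereWindowCollisionCount

/-!
# `stub_reduction` of the line `contact-source-duhamel`, helper file 5/6: bounds along a good orbit
(crux `CollisionIsometryCLT.AdaptedWeightCLT`, stmt-AtomisticToContinuum-14868 = rev-12 TIME-LOCAL crux; `--supports`)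

For a GOOD datum `z` of a hard-sphere flow `Φ` of `N + 1` spheres of diameter `hsDiameter σ N` on `𝕋³`
(regular geometry, `0 ≤ σ < 1/2`) the data entering the line's functionals are bounded on a horizon `[0, t]`:
* VELOCITY BOUNDS: energy conservation along the orbit (`IsHardSphereTrajectory.configEnergy_eq_holds`) and
  along the fold (`sum_sq_velAfter`) bound every flow / fold velocity by `vR z = √(Σ_j ‖v_j(0)‖²)`;
* FINITELY MANY FOLD STEPS: the number of fold steps over a window `[s, s + Δ] ⊆ [0, T]` is at most the
  number of collision times of the orbit in `[0, T]` (`reduction_steps_flow_le`: the Alexander instants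
  restarted at `Φ_s z` are finite, strictly increasing and collision times of `u ↦ Φ_{u+s} z`,
  `IsHardSphereTrajectory.stateAfter_eq_apply`, `freeExitTime_apply_pos`; local finiteness of collisions);
* SUP BOUNDS of `pastF`, `xiF`, `xiChF` for bounded weights, velocities, shift and number of steps (from the
  sup-norm bounds of `…TLReductionBounds`: transport by `KT ^ K`, window sums of `≤ K` terms).
Registered anchor: `reduction_steps_flow_le`.
-/

namespace Summit.AtomisticToContinuum.HydrodynamicLimit.Theorems.ContactSourceDuhamel.TimeLocal.Reduction

open scoped BigOperators Topology Classical MeasureTheory ENNReal InnerProductSpace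
open Filter Set MeasureTheory
open Literature.Analysis.FluidPDE
open Literature.MathematicalPhysics.KineticTheory (hsDiameter hsDiameter_le)

noncomputable section

variable {σ : ℝ} {N : ℕ} {r : ℕ}

/-! ## Good orbits: velocity bounds -/

/-- The velocity radius `√(Σ_j ‖v_j‖²)` of a configuration. -/
def vR (z : Cfg N) : ℝ := Real.sqrt (∑ j, ‖(z j).2‖ ^ 2)

/-- The velocity radius is nonnegative. -/
theorem vR_nonneg (z : Cfg N) : 0 ≤ vR z := Real.sqrt_nonneg _

/-- Energy conservation along a good orbit: `Σ_j ‖v_j(s)‖² = Σ_j ‖v_j(0)‖²`. -/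
theorem sum_sq_flow (Φ : Flow σ N) {z : Cfg N} (hz : z ∈ Φ.good) (s : ℝ) :
    ∑ j, ‖(Φ.flow s z j).2‖ ^ 2 = ∑ j, ‖(z j).2‖ ^ 2 := by
  have h := IsHardSphereTrajectory.configEnergy_eq_holds (Φ.isTrajectory z hz) s 0
  rw [Φ.flow_zero z hz] at h
  unfold configEnergy at h
  simpa using h

/-- Velocity bound along a good orbit: `‖v_i(s)‖ ≤ vR z`. -/
theorem norm_vel_flow_le (Φ : Flow σ N) {z : Cfg N} (hz : z ∈ Φ.good) (s : ℝ) (i : Fin (N + 1)) :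
    ‖(Φ.flow s z i).2‖ ≤ vR z := by
  unfold vR
  rw [← sum_sq_flow Φ hz s]
  exact Real.le_sqrt_of_sq_le (Finset.single_le_sum (f := fun j => ‖(Φ.flow s z j).2‖ ^ 2)
    (fun j _ => sq_nonneg _) (Finset.mem_univ i))

/-- Velocity bound along the fold restarted anywhere on a good orbit: `‖velAfter σ N (Φ_s z) m i‖ ≤ vR z`. -/
theorem norm_velAfter_flow_le (Φ : Flow σ N) {z : Cfg N} (hz : z ∈ Φ.good) (s : ℝ) (m : ℕ)
    (i : Fin (N + 1)) : ‖velAfter σ N (Φ.flow s z) m i‖ ≤ vR z := by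
  unfold vR
  rw [← sum_sq_flow Φ hz s]
  exact norm_velAfter_le_sqrt _ _ _

/-! ## Finitely many fold steps along a good orbit -/

/-- **Finitely many fold steps along a good orbit** (registered anchor of this helper file). For a good
datum `z` of a hard-sphere flow `Φ` (regular geometry), the number of fold steps of the crux's transfer
restarted at `Φ_s z` over a window `[0, Δ]` with `0 ≤ s`, `0 ≤ Δ`, `s + Δ ≤ T` is at most the number of
collision times of the orbit of `z` in `[0, T]`: the collision instants of the Alexander construction
started at `Φ_s z` are finite, strictly increasing and (from the first on) collision times of
`u ↦ Φ_u (Φ_s z) = Φ_{u+s} z` (`IsHardSphereTrajectory.stateAfter_eq_apply`, `freeExitTime_apply_pos`). -/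
theorem reduction_steps_flow_le : ∀ (σ : ℝ) (N : ℕ),
    (Literature.Analysis.FluidPDE.Torus.geometry (Fin 3)).IsHardSphereRegular
      (Literature.MathematicalPhysics.KineticTheory.hsDiameter σ N) →
    ∀ (Φ : Flow σ N) (z : Cfg N) (hz : z ∈ Φ.good) (s Δ T : ℝ), 0 ≤ s → 0 ≤ Δ → s + Δ ≤ T →
      steps σ N (Φ.flow s z) Δ ≤ ((Φ.isTrajectory z hz).locFinite 0 T).toFinset.card := by
  intro σ N hG Φ z hz s Δ T hs hΔ hsT
  set y := Φ.flow s z with hy_def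
  have hy : y ∈ Φ.good := Φ.mapsTo_good s hz
  have hγ : IsHardSphereTrajectory (Torus.geometry (Fin 3)) (hsDiameter σ N) (N + 1)
      (fun u => Φ.flow u y) := Φ.isTrajectory y hy
  set K := ((Φ.isTrajectory z hz).locFinite 0 T).toFinset.card with hK
  refine Alexander.collisionCount_le_of_lt_collisionInstant (lt_of_not_ge fun hle => ?_)
  have hfin : ∀ k, k ≤ K + 1 →
      Alexander.collisionInstant (Torus.geometry (Fin 3)) (hsDiameter σ N) y k ≠ ∞ := fun k hk =>
    ne_top_of_le_ne_top ENNReal.ofReal_ne_top ((Alexander.monotone_collisionInstant y hk).trans hle)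
  have hstate : ∀ k, k ≤ K + 1 →
      Alexander.stateAfter (Torus.geometry (Fin 3)) (hsDiameter σ N) y k =
          Φ.flow (Alexander.collisionInstant (Torus.geometry (Fin 3)) (hsDiameter σ N) y k).toReal y ∧
        (0 < k → (Alexander.collisionInstant (Torus.geometry (Fin 3)) (hsDiameter σ N) y k).toReal ∈
          collisionTimes (Torus.geometry (Fin 3)) (hsDiameter σ N) (fun u => Φ.flow u y)) := by
    intro k hk
    have h0 : Φ.flow 0 y = y := Φ.flow_zero y hy
    have h := hγ.stateAfter_eq_apply hG (k := k) (by rw [h0]; exact hfin k hk)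
    rw [h0] at h
    exact h
  -- the instants strictly increase up to `K + 1`
  have hmono : StrictMonoOn
      (fun k => (Alexander.collisionInstant (Torus.geometry (Fin 3)) (hsDiameter σ N) y k).toReal)
      (Set.Iic (K + 1)) := by
    refine strictMonoOn_Iic_of_lt_succ fun m hm => ?_
    have hm' : m + 1 ≤ K + 1 := hm
    have hpos : 0 < Alexander.freeExitTime (Torus.geometry (Fin 3)) (hsDiameter σ N)
        (Alexander.stateAfter (Torus.geometry (Fin 3)) (hsDiameter σ N) y m) := by
      rw [(hstate m (Nat.le_of_succ_le hm')).1]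
      exact hγ.freeExitTime_apply_pos hG _
    show (Alexander.collisionInstant (Torus.geometry (Fin 3)) (hsDiameter σ N) y m).toReal <
      (Alexander.collisionInstant (Torus.geometry (Fin 3)) (hsDiameter σ N) y (Order.succ m)).toReal
    rw [Order.succ_eq_add_one,
      ENNReal.toReal_lt_toReal (hfin m (Nat.le_of_succ_le hm')) (hfin (m + 1) hm'),
      Alexander.collisionInstant_succ]
    exact ENNReal.lt_add_right (hfin m (Nat.le_of_succ_le hm')) hpos.ne'
  -- the shifted instants `t_k + s`, `1 ≤ k ≤ K + 1`, are distinct collision times of `z` in `[0, T]`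
  have hsub : (Finset.Icc 1 (K + 1)).image
      (fun k => (Alexander.collisionInstant (Torus.geometry (Fin 3)) (hsDiameter σ N) y k).toReal + s) ⊆
      ((Φ.isTrajectory z hz).locFinite 0 T).toFinset := by
    intro τ hτ
    obtain ⟨k, hk, rfl⟩ := Finset.mem_image.1 hτ
    obtain ⟨hk1, hkK⟩ := Finset.mem_Icc.1 hk
    rw [Set.Finite.mem_toFinset]
    obtain ⟨i, j, hij, hc⟩ := (hstate k hkK).2 hk1
    refine ⟨⟨i, j, hij, ?_⟩, ?_, ?_⟩
    · show Φ.flow ((Alexander.collisionInstant (Torus.geometry (Fin 3)) (hsDiameter σ N) y k).toReal + s)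
        z ∈ _
      rw [Φ.flow_add _ _ z hz]
      exact hc
    · exact add_nonneg ENNReal.toReal_nonneg hs
    · have hle' : (Alexander.collisionInstant (Torus.geometry (Fin 3)) (hsDiameter σ N) y k).toReal ≤ Δ :=
        ENNReal.toReal_le_of_le_ofReal hΔ ((Alexander.monotone_collisionInstant y hkK).trans hle)
      linarith
  have hinj : Set.InjOn
      (fun k => (Alexander.collisionInstant (Torus.geometry (Fin 3)) (hsDiameter σ N) y k).toReal + s)
      (Finset.Icc 1 (K + 1) : Set ℕ) := by
    intro a ha b hb hab
    have hab' : (Alexander.collisionInstant (Torus.geometry (Fin 3)) (hsDiameter σ N) y a).toReal =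
        (Alexander.collisionInstant (Torus.geometry (Fin 3)) (hsDiameter σ N) y b).toReal :=
      add_right_cancel hab
    exact hmono.injOn (Finset.mem_Icc.1 (Finset.mem_coe.1 ha)).2
      (Finset.mem_Icc.1 (Finset.mem_coe.1 hb)).2 hab'
  have hcard := Finset.card_le_card hsub
  rw [Finset.card_image_of_injOn hinj, Nat.card_Icc] at hcard
  omega

/-- The line window is nonnegative. -/
theorem winLen_nonneg (N : ℕ) (s : ℝ) : 0 ≤ winLen N s := by
  unfold winLen Δℓ
  split_ifs
  · exact le_rfl
  · exact mul_nonneg (Real.rpow_nonneg (by positivity) _) (Real.log_nonneg (by linarith))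

/-- The window start time `s − winLen N s` is nonnegative for `s ≥ 0`. -/
theorem sub_winLen_nonneg (N : ℕ) {s : ℝ} (hs : 0 ≤ s) : 0 ≤ s - winLen N s := by
  unfold winLen
  split_ifs with h
  · simpa using hs
  · linarith [not_lt.1 h]

/-- **Collision budget of the line window**: for `s ∈ [0, t]` the number of fold steps of the window ending
at `s` is at most the number `K` of collision times of the orbit in `[0, t]`. -/
theorem steps_win_le (hG : (Torus.geometry (Fin 3)).IsHardSphereRegular (hsDiameter σ N)) (Φ : Flow σ N)
    {z : Cfg N} (hz : z ∈ Φ.good) {t s : ℝ} (hs : s ∈ Icc 0 t) :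
    steps σ N (winStart σ N Φ s z) (winLen N s) ≤ ((Φ.isTrajectory z hz).locFinite 0 t).toFinset.card :=
  reduction_steps_flow_le σ N hG Φ z hz _ _ t (sub_winLen_nonneg N hs.1) (winLen_nonneg N s)
    (by linarith [hs.2])

/-! ## Sup bounds of the fold functionals for bounded data -/

/-- PAST is bounded when weights, velocities, shift and the number of steps are. -/
theorem abs_pastF_le_of (y : Cfg N) (m : ℕ) (w : Fin (N + 1) → ℝ) (u : V3) (C : Tens r) {R Cw : ℝ}
    {K : ℕ} (hR : 0 ≤ R) (hCw : 0 ≤ Cw) (hw : ∀ i, |w i| ≤ Cw) (hy : ∀ k, ‖(y k).2‖ ≤ R)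
    (hu : ‖u‖ ≤ R) (hm : m ≤ K) :
    |pastF r σ N y m w u C| ≤ Cw * (cT r * ‖C‖ * (KT r ^ K * (2 * R) ^ r)) := by
  have hcT : 0 ≤ cT r := zero_le_one.trans (one_le_cT r)
  have hK0 : 0 ≤ KT r := zero_le_one.trans (one_le_KT r)
  have h2R : 0 ≤ (2 * R) ^ r := pow_nonneg (by linarith) r
  have hT0 : ‖(fun k => tpow r ((y k).2 - u) : Fin (N + 1) → Tens r)‖ ≤ (2 * R) ^ r := by
    refine (pi_norm_le_iff_of_nonneg h2R).2 fun k => (norm_tpow_le _).trans ?_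
    exact pow_le_pow_left₀ (norm_nonneg _) ((norm_sub_le _ _).trans (by linarith [hy k, hu])) r
  have hTT : ‖tTransport r σ N y 0 m (fun k => tpow r ((y k).2 - u))‖ ≤ KT r ^ K * (2 * R) ^ r :=
    (norm_tTransport_le _ _ _ _).trans (mul_le_mul (pow_le_pow_right₀ (one_le_KT r) hm) hT0
      (norm_nonneg _) (pow_nonneg hK0 _))
  unfold pastF
  refine abs_avg_le _ fun i => ?_
  rw [abs_mul]
  refine mul_le_mul (hw i) ((abs_pairT_le C _).trans ?_) (abs_nonneg _) hCw
  exact mul_le_mul_of_nonneg_left ((norm_le_pi_norm _ i).trans hTT) (by positivity)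

/-- A window sum of `m ≤ K` bounded terms, averaged over the particles, is bounded by `K` times the bound. -/
theorem abs_winSum_le {m K : ℕ} {B : ℝ} (hB : 0 ≤ B) (hm : m ≤ K) (a : ℕ → Fin (N + 1) → ℝ)
    (ha : ∀ l, l < m → ∀ i, |a l i| ≤ B) :
    |(((N + 1 : ℕ) : ℝ))⁻¹ * ∑ l ∈ Finset.range m, ∑ i : Fin (N + 1), a l i| ≤ K * B := by
  have hN : (0 : ℝ) < ((N + 1 : ℕ) : ℝ) := by positivity
  rw [abs_mul, abs_inv, abs_of_pos hN]
  calc (((N + 1 : ℕ) : ℝ))⁻¹ * |∑ l ∈ Finset.range m, ∑ i : Fin (N + 1), a l i|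
      ≤ (((N + 1 : ℕ) : ℝ))⁻¹ * ∑ l ∈ Finset.range m, ∑ _i : Fin (N + 1), B := by
        refine mul_le_mul_of_nonneg_left ((Finset.abs_sum_le_sum_abs _ _).trans
          (Finset.sum_le_sum fun l hl => (Finset.abs_sum_le_sum_abs _ _).trans
            (Finset.sum_le_sum fun i _ => ha l (Finset.mem_range.1 hl) i))) (inv_nonneg.2 hN.le)
    _ = m * B := by
        rw [Finset.sum_const, Finset.sum_const, Finset.card_range, Finset.card_univ, Fintype.card_fin,
          nsmul_eq_mul, nsmul_eq_mul]
        field_simp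
    _ ≤ K * B := mul_le_mul_of_nonneg_right (Nat.cast_le.2 hm) hB

/-- Ξ is bounded when weights, fold velocities, shift and the number of steps are. -/
theorem abs_xiF_le_of (y : Cfg N) (m : ℕ) (w : Fin (N + 1) → ℝ) (u : V3) (C : Tens r) {R Cw : ℝ}
    {K : ℕ} (hR : 0 ≤ R) (hCw : 0 ≤ Cw) (hw : ∀ i, |w i| ≤ Cw) (hV : ∀ l i, ‖velAfter σ N y l i‖ ≤ R)
    (hu : ‖u‖ ≤ R) (hm : m ≤ K) :
    |xiF r σ N y m w u C| ≤ K * (Cw * (cT r * ‖C‖ * (KT r ^ K * (cS r * (4 * R) ^ r)))) := by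
  have hcT : 0 ≤ cT r := zero_le_one.trans (one_le_cT r)
  have hK0 : 0 ≤ KT r := zero_le_one.trans (one_le_KT r)
  have hS0 : 0 ≤ cS r * (4 * R) ^ r := mul_nonneg (cS_nonneg r) (pow_nonneg (by linarith) r)
  unfold xiF
  refine abs_winSum_le (by positivity) hm _ fun l hl i => ?_
  rw [abs_mul]
  refine mul_le_mul (hw i) ((abs_pairT_le C _).trans ?_) (abs_nonneg _) hCw
  refine mul_le_mul_of_nonneg_left ((norm_le_pi_norm _ i).trans
    ((norm_tTransport_le _ _ _ _).trans ?_)) (by positivity)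
  exact mul_le_mul (pow_le_pow_right₀ (one_le_KT r) (by omega)) (norm_src_le y u l hR (hV l) hu)
    (norm_nonneg _) (pow_nonneg hK0 _)

/-- Ξ^ch is bounded when (nonnegative) weights, fold velocities, shift and the number of steps are. -/
theorem abs_xiChF_le_of (y : Cfg N) (m : ℕ) (w : Fin (N + 1) → ℝ) (u : V3) (C : Tens r) {R Cw : ℝ}
    {K : ℕ} (hR : 0 ≤ R) (hCw : 0 ≤ Cw) (hw : ∀ i, |w i| ≤ Cw) (hw0 : ∀ i, 0 ≤ w i)
    (hV : ∀ l i, ‖velAfter σ N y l i‖ ≤ R) (hu : ‖u‖ ≤ R) (hm : m ≤ K) :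
    |xiChF r σ N y m w u C| ≤ K * (Cw * (cT r * ‖C‖ * (KT r ^ K * (cS r * (4 * R) ^ r)))) := by
  have hcT : 0 ≤ cT r := zero_le_one.trans (one_le_cT r)
  have hK0 : 0 ≤ KT r := zero_le_one.trans (one_le_KT r)
  have hS0 : 0 ≤ cS r * (4 * R) ^ r := mul_nonneg (cS_nonneg r) (pow_nonneg (by linarith) r)
  unfold xiChF
  refine abs_winSum_le (by positivity) hm _ fun l hl i => ?_
  rw [abs_mul]
  refine mul_le_mul (hw i) ((abs_pairT_le C _).trans ?_) (abs_nonneg _) hCw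
  refine mul_le_mul_of_nonneg_left ((norm_le_pi_norm _ i).trans
    ((norm_tTransport_le _ _ _ _).trans ?_)) (by positivity)
  exact mul_le_mul (pow_le_pow_right₀ (one_le_KT r) (by omega)) (norm_srcCh_le y w u l hR hw0 (hV l) hu)
    (norm_nonneg _) (pow_nonneg hK0 _)

end

end Summit.AtomisticToContinuum.HydrodynamicLimit.Theorems.ContactSourceDuhamel.TimeLocal.Reduction
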